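import Summits.BirchSwinnertonDyer.BirchSwinnertonDyer.Theorems.KimAtThreeFineKatoKPortResidueField
import Literature.NumberTheory.AdelicBaseChange.PadicTensorCompletionProofs
import Literature.NumberTheory.DiophantineGeometry.AbcWave0UniformABCProofs
import Mathlib.NumberTheory.NumberField.Completion.FinitePlace
import Mathlib.NumberTheory.Padics.HeightOneSpectrum
import Mathlib.Topology.Algebra.Valued.NormedValued
import HarnessLib

/-!
# K-PORT junction (T5), DEFINITIONS: the completion `L_w` of a number field at a place `w ∣ p`, re-normed
# as a complete ultrametric normed `ℚ_p`-ALGEBRA `KPort.Kw p L w` (‖p‖ = p⁻¹) — the `K` of the port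
# (cell `bsd-addord`, seat w2-kport gen 2; `--supports stmt-BirchSwinnertonDyer-19560`, helper; REVIEW lane: definitions)

HONEST FRAMING. Route W2 (`route-BirchSwinnertonDyer-KimAtThreeKolyvagin`), crux 19560
`KatoKuriharaPortThreeShared`, residual ⟨C1⟩ clause (C1.c)/(d). The K-port (`…KimAtThreeFineKatoKPort*`,
seats w2-kport/w2-acc4) proves the E-side of SAT₀ — `Λ̃ = satLog` on `E₀(K)`, `‖Λ̃‖ ≤ 1`, the unit-trace
point (`KPort.consumer_of_addv`) — for an ABSTRACT `K` with `[NontriviallyNormedField K] [NormedAlgebra ℚ_[p] K]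
[IsUltrametricDist K] [CompleteSpace K] [FiniteDimensional ℚ_[p] K] [IsGalois ℚ_[p] K]` and
`hK : ‖x‖ < 1 → ‖x‖ ≤ ‖p‖`. kim3's per-factor package `hKloc` (`semiLocalInt_package_of_perFactor`,
p495892) consumes it at `K := L_w = w.1.adicCompletion L`, `L = ℚ(ζ_m)`, `w ∣ v_p` (junction spec
HOME/kim3/KIM3-W2-C1c-SEMILOCAL-g14.md §3: (J1) `‖x‖ ≤ 1 ↔ x ∈ 𝒪_w`, (J2) `algebraMap ℚ_[p] L_w =
algebraMap ℚ_v L_w ∘ e_p`, (J3) trace compatibility). OBSTRUCTION (kport inventory (I1)): Mathlib's norm on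
`w.1.adicCompletion L` (`instNormedFieldValuedAdicCompletion`, rank-one base `Nw = p^f`) has `‖p‖ = p^{-ef}`,
so for `f > 1` it carries NO `NormedAlgebra ℚ_[p]` structure. THIS FILE defines the remedy: a TYPE
SYNONYM `Kw p L w := w.1.adicCompletion L` with the SAME field / valued / uniform structure but the rank-one
structure of base `p` (Mathlib `Valuation.IsRankOneDiscrete.rankOne` with `e = p`), hence
`‖x‖ = p^{v_w(x)}` and, for `w` unramified over `p`, `‖p‖ = p⁻¹`; and the `ℚ_[p]`-algebra structure
`algebraMap := (ℚ_v → L_w) ∘ e_p` (`e_p = Padic.adicCompletionEquiv (𝓞 ℚ) p`, the currency of w2-acc4's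
`exists_padicTensorAlgEquiv`). Instances live on the NEW type only (nothing on Mathlib's types is
overridden). Besides the definitions this file proves what the INSTANCES need: the norm of `K_w` extends
`|·|_p` when `e(w∣p) = 1` (`norm_algebraMap_eq`: `ℤ_p ↦ 𝒪_w`, `‖u‖ = 1 ⇒ ‖ι u‖ = 1`, `r = u·p^n`), whence
`NormedAlgebra ℚ_[p] K_w`; `FiniteDimensional ℚ_[p] K_w` (`ℚ_[p] ≅ ℚ_v`, packet finiteness); and the port's
`hK`. (J3), `IsGalois` and the clause-(d) data are the sibling PROOF files `…KPortJunction*`. No named fact,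
no `sorry`; closes nothing by itself; nothing booked.

## Contents (`v := primesEquiv.symm p`, `L_w := w.1.adicCompletion L`, `ℚ_v := v.adicCompletion ℚ`)

* `Kw p L w` (type synonym of `L_w`); instances `Field`, `Valued _ ℤᵐ⁰`, `IsRankOneDiscrete`,
  **`Kw.rankOne`** (base `p`), **`NontriviallyNormedField`** (`Valued.toNontriviallyNormedField`; same
  uniformity ⇒ `CompleteSpace`, `IsUltrametricDist` inherited), `Algebra ℚ_v (Kw p L w)` (the packet's),
  **`Algebra ℚ_[p] (Kw p L w)`** (`∘ e_p`), `Module.Finite ℚ_v (Kw p L w)`.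
* `Kw.toCompletion` : `Kw p L w ≃+* L_w` (the identity) and its `rfl` lemmas; `Kw.rankOne_hom'_def`,
  **`Kw.norm_def'`** (`‖x‖ = toNNReal p (v_w x)`), **`Kw.norm_le_one_iff`** / `mem_unitBall_iff_mem_adicCompletionIntegers`
  ((J1)), `Kw.norm_lt_one_iff`, `Kw.norm_eq_zpow`, **`Kw.algebraMap_eq`** ((J2), `rfl`).
* valuations along `ℚ_[p] → ℚ_v → K_w`: `valued_completion_natCast_prime` (`v_p(p) = exp(−1)`),
  `valued_algebraMap_completion` (`v_w ∘ ι = v_p^{e}`), `valued_natCast_prime`, **`norm_natCast_prime`**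
  (`‖p‖ = p⁻¹` if `e(w∣p) = 1`); `norm_algebraMap_padicInt_le_one` (`ℤ_p → 𝒪_w`),
  `norm_algebraMap_eq_one_of_norm_eq_one`, **`norm_algebraMap_eq`** (`‖algebraMap r‖ = ‖r‖`, `e = 1`),
  instance **`Kw.instNormedAlgebra`** (under `[Fact (e(w∣p) = 1)]`), instance **`Kw.instFiniteDimensional`**
  (`FiniteDimensional ℚ_[p] K_w`), **`norm_le_norm_prime_of_norm_lt_one`** (the port's `hK`), `isUltrametricDist`.
  NOT here: `IsGalois ℚ_[p] K_w` and the trace compatibility (J3) — sibling proof files.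

References: J. W. S. Cassels, A. Fröhlich, *Algebraic Number Theory* (1967), Ch. II §10 [CasselsFrohlichANT1967];
J.-P. Serre, *Local Fields* (1979), Ch. II §1–§3 [SerreLocalFields1979]; kim3 memo KIM3-W2-C1c-SEMILOCAL-g14 §3.
-/

noncomputable section

-- the cell's Theorems namespace `Summit.BirchSwinnertonDyer.BirchSwinnertonDyer.…` repeats the summit name by design (D-0017)
set_option linter.dupNamespace false

open scoped NNReal
open IsDedekindDomain NumberField WithZeroMulInt

namespace Summit.BirchSwinnertonDyer.BirchSwinnertonDyer.Theorems.KPort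

open Literature.NumberTheory.GaloisRepresentations.LubinTate (unitBall mem_unitBall_iff)

variable (p : ℕ) [hp : Fact p.Prime] (L : Type) [Field L] [NumberField L]
  (w : ((Rat.HeightOneSpectrum.primesEquiv (R := 𝓞 ℚ)).symm ⟨p, hp.out⟩).Extension (𝓞 L))

/-- **`K_w`**: the completion `L_w = w.1.adicCompletion L` of the number field `L` at a place `w` over
`p`, as a TYPE SYNONYM to be re-normed with `‖p‖ = p⁻¹` (kport inventory (I1)). [folklore] -/
def Kw : Type := w.1.adicCompletion L

namespace Kw

/-- The field structure of `L_w`. [folklore] -/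
instance instField : Field (Kw p L w) := inferInstanceAs (Field (w.1.adicCompletion L))

/-- The `w`-adic valuation of `L_w` (values in `ℤᵐ⁰`), with its valued-field topology. [folklore] -/
instance instValued : Valued (Kw p L w) (WithZero (Multiplicative ℤ)) :=
  inferInstanceAs (Valued (w.1.adicCompletion L) (WithZero (Multiplicative ℤ)))

/-- The valuation is discrete of rank one (Mathlib, for any completion of a number field). [folklore] -/
instance instIsRankOneDiscrete : (Valued.v : Valuation (Kw p L w) (WithZero (Multiplicative ℤ))).IsRankOneDiscrete :=
  inferInstanceAs ((Valued.v : Valuation (w.1.adicCompletion L) (WithZero (Multiplicative ℤ))).IsRankOneDiscrete)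

/-- `1 < p` in `ℝ≥0`. [folklore] -/
theorem one_lt_prime : 1 < (p : ℝ≥0) := by exact_mod_cast hp.out.one_lt

/-- `(p : ℝ≥0) ≠ 0`. [folklore] -/
theorem prime_ne_zero : (p : ℝ≥0) ≠ 0 := ne_of_gt (lt_trans zero_lt_one (one_lt_prime p))

/-- **The rank-one structure of BASE `p`** on the `w`-adic valuation: `v_w ↦ p^{v_w}` (Mathlib's own
instance on `w.1.adicCompletion L` uses base `Nw = p^f`). [cite: SerreLocalFields1979, Ch. II §1] -/
instance rankOne : (Valued.v : Valuation (Kw p L w) (WithZero (Multiplicative ℤ))).RankOne :=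
  Valuation.IsRankOneDiscrete.rankOne _ (one_lt_prime p)

/-- **`K_w` as a nontrivially normed field**, `‖x‖ = p^{v_w(x)}` (Mathlib `Valued.toNontriviallyNormedField`;
the uniformity is the valued one, so completeness and the ultrametric inequality are inherited). [cite: SerreLocalFields1979, Ch. II §1] -/
instance instNontriviallyNormedField : NontriviallyNormedField (Kw p L w) :=
  Valued.toNontriviallyNormedField (Kw p L w) (WithZero (Multiplicative ℤ))

/-- `K_w` is complete (it is `L_w`). [folklore] -/
instance instCompleteSpace : CompleteSpace (Kw p L w) := inferInstanceAs (CompleteSpace (w.1.adicCompletion L))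

/-- The `ℚ_v`-algebra structure of `L_w` (the tree's FLT packet `CompletionBaseChange`). [cite: CasselsFrohlichANT1967, Ch. II §10] -/
instance instAlgebraCompletion :
    Algebra (((Rat.HeightOneSpectrum.primesEquiv (R := 𝓞 ℚ)).symm ⟨p, hp.out⟩).adicCompletion ℚ) (Kw p L w) :=
  inferInstanceAs (Algebra (((Rat.HeightOneSpectrum.primesEquiv (R := 𝓞 ℚ)).symm ⟨p, hp.out⟩).adicCompletion ℚ)
    (w.1.adicCompletion L))

/-- `L_w` is finite over `ℚ_v` (packet). [cite: CasselsFrohlichANT1967, Ch. II §10] -/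
instance instModuleFiniteCompletion :
    Module.Finite (((Rat.HeightOneSpectrum.primesEquiv (R := 𝓞 ℚ)).symm ⟨p, hp.out⟩).adicCompletion ℚ) (Kw p L w) :=
  inferInstanceAs (Module.Finite (((Rat.HeightOneSpectrum.primesEquiv (R := 𝓞 ℚ)).symm ⟨p, hp.out⟩).adicCompletion ℚ)
    (w.1.adicCompletion L))

/-- **The `ℚ_[p]`-algebra structure of `K_w`**: `ℚ_[p] ≅ ℚ_v → L_w`, `algebraMap := (ℚ_v → L_w) ∘ e_p`
with `e_p = Padic.adicCompletionEquiv (𝓞 ℚ) p` ((J2) by construction). [cite: CasselsFrohlichANT1967, Ch. II §10] -/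
instance instAlgebraPadic : Algebra ℚ_[p] (Kw p L w) :=
  ((algebraMap (((Rat.HeightOneSpectrum.primesEquiv (R := 𝓞 ℚ)).symm ⟨p, hp.out⟩).adicCompletion ℚ)
      (w.1.adicCompletion L)).comp
    (Padic.adicCompletionEquiv (𝓞 ℚ) ⟨p, hp.out⟩).toRingEquiv.toRingHom).toAlgebra

/-- The identity `K_w = L_w` as a ring isomorphism (for statements in the `L_w` currency). [folklore] -/
def toCompletion : Kw p L w ≃+* w.1.adicCompletion L := RingEquiv.refl _

variable {p L w}

/-- `toCompletion` is the identity. [folklore] -/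
@[simp] theorem toCompletion_apply (x : Kw p L w) : toCompletion p L w x = (x : w.1.adicCompletion L) := rfl

/-- The valuation of `K_w` is that of `L_w`. [folklore] -/
theorem valued_toCompletion (x : Kw p L w) :
    Valued.v (toCompletion p L w x) = (Valued.v x : WithZero (Multiplicative ℤ)) := rfl

/-- **(J2)** `algebraMap ℚ_[p] K_w = (algebraMap ℚ_v L_w) ∘ e_p`. [folklore] -/
theorem algebraMap_eq (r : ℚ_[p]) :
    toCompletion p L w (algebraMap ℚ_[p] (Kw p L w) r) =
      algebraMap (((Rat.HeightOneSpectrum.primesEquiv (R := 𝓞 ℚ)).symm ⟨p, hp.out⟩).adicCompletion ℚ)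
        (w.1.adicCompletion L) (Padic.adicCompletionEquiv (𝓞 ℚ) ⟨p, hp.out⟩ r) := rfl

/-- `algebraMap ℚ_v K_w` is the packet's `algebraMap ℚ_v L_w`. [folklore] -/
theorem algebraMap_completion_eq (y : ((Rat.HeightOneSpectrum.primesEquiv (R := 𝓞 ℚ)).symm ⟨p, hp.out⟩).adicCompletion ℚ) :
    toCompletion p L w (algebraMap _ (Kw p L w) y) = algebraMap _ (w.1.adicCompletion L) y := rfl

/-- The `hom'` of the base-`p` rank-one structure. [folklore] -/
theorem rankOne_hom'_def :
    (rankOne p L w).hom' = (toNNReal (prime_ne_zero p)).comp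
      (MonoidWithZeroHom.ofClass (Valuation.IsRankOneDiscrete.valueGroup₀_equiv_withZeroMulInt
        (Valued.v : Valuation (Kw p L w) (WithZero (Multiplicative ℤ))))) := rfl

/-- The valuation of `K_w` is onto `ℤᵐ⁰`. [folklore] -/
theorem valued_surjective : Function.Surjective (Valued.v : Valuation (Kw p L w) (WithZero (Multiplicative ℤ))) :=
  w.1.valuedAdicCompletion_surjective L

/-- **`‖x‖ = p^{v_w(x)}`** on `K_w` (`toNNReal` of base `p`). [cite: SerreLocalFields1979, Ch. II §1] -/
theorem norm_def' (x : Kw p L w) : ‖x‖ = toNNReal (prime_ne_zero p) (Valued.v x) := by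
  simp [Valued.toNormedField.norm_def, Valuation.RankOne.hom, rankOne_hom'_def,
    Valuation.IsRankOneDiscrete.valueGroup₀_equiv_withZeroMulInt_restrict_apply_of_surjective valued_surjective]

/-- **(J1)** `‖x‖ ≤ 1 ↔ v_w(x) ≤ 1`. [cite: SerreLocalFields1979, Ch. II §1] -/
theorem norm_le_one_iff (x : Kw p L w) : ‖x‖ ≤ 1 ↔ Valued.v x ≤ (1 : WithZero (Multiplicative ℤ)) := by
  rw [norm_def', ← NNReal.coe_one, NNReal.coe_le_coe, ← (toNNReal_strictMono (one_lt_prime p)).le_iff_le, map_one]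

/-- **(J1)** the port's `unitBall K_w` is `𝒪_w = w.1.adicCompletionIntegers L`. [cite: SerreLocalFields1979, Ch. II §1] -/
theorem mem_unitBall_iff_mem_adicCompletionIntegers (x : Kw p L w) :
    x ∈ unitBall (Kw p L w) ↔ toCompletion p L w x ∈ w.1.adicCompletionIntegers L := by
  rw [mem_unitBall_iff, norm_le_one_iff, HeightOneSpectrum.mem_adicCompletionIntegers]; rfl

/-- `‖x‖ < 1 ↔ v_w(x) < 1`. [cite: SerreLocalFields1979, Ch. II §1] -/
theorem norm_lt_one_iff (x : Kw p L w) : ‖x‖ < 1 ↔ Valued.v x < (1 : WithZero (Multiplicative ℤ)) := by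
  rw [norm_def', ← NNReal.coe_one, NNReal.coe_lt_coe, ← (toNNReal_strictMono (one_lt_prime p)).lt_iff_lt, map_one]

/-- `‖x‖ = p ^ n` when `v_w(x) = exp n`. [cite: SerreLocalFields1979, Ch. II §1] -/
theorem norm_eq_zpow {x : Kw p L w} {n : ℤ} (hx : Valued.v x = (WithZero.exp n : WithZero (Multiplicative ℤ))) :
    ‖x‖ = (p : ℝ) ^ n := by
  rw [norm_def', hx]
  simp [toNNReal, WithZero.exp]

/-! ## Valuations along `ℚ_[p] → ℚ_v → K_w`; `‖p‖ = p⁻¹` for unramified `w` -/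

/-- `v_p(p) = exp(−1)` in `ℚ_v` (`p` generates the place `v = primesEquiv.symm p`). [folklore] -/
theorem valued_completion_natCast_prime :
    Valued.v ((p : ℕ) : ((Rat.HeightOneSpectrum.primesEquiv (R := 𝓞 ℚ)).symm ⟨p, hp.out⟩).adicCompletion ℚ) =
      (WithZero.exp (-1 : ℤ) : WithZero (Multiplicative ℤ)) := by
  set v : HeightOneSpectrum (𝓞 ℚ) := (Rat.HeightOneSpectrum.primesEquiv (R := 𝓞 ℚ)).symm ⟨p, hp.out⟩ with hvdef
  have hnat : Rat.HeightOneSpectrum.natGenerator v = p :=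
    congrArg Subtype.val ((Rat.HeightOneSpectrum.primesEquiv (R := 𝓞 ℚ)).apply_symm_apply ⟨p, hp.out⟩)
  have hv : v.asIdeal = Ideal.span {((p : ℕ) : 𝓞 ℚ)} := by
    rw [Literature.NumberTheory.DiophantineGeometry.UniformABCConjecture.asIdeal_eq_span_natGenerator v, hnat]
  rw [← map_natCast (algebraMap ℚ (v.adicCompletion ℚ)) p, HeightOneSpectrum.algebraMap_adicCompletion,
    Function.comp_apply, map_natCast, HeightOneSpectrum.valuedAdicCompletion_eq_valuation',
    show ((p : ℕ) : ℚ) = algebraMap (𝓞 ℚ) ℚ (p : 𝓞 ℚ) by simp, HeightOneSpectrum.valuation_of_algebraMap]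
  exact HeightOneSpectrum.intValuation_singleton v (by exact_mod_cast hp.out.ne_zero) hv

/-- `v_w(ι y) = v_p(y)^{e(w∣p)}` for the structure map `ι : ℚ_v → K_w` (packet). [cite: CasselsFrohlichANT1967, Ch. II §10] -/
theorem valued_algebraMap_completion (y : ((Rat.HeightOneSpectrum.primesEquiv (R := 𝓞 ℚ)).symm ⟨p, hp.out⟩).adicCompletion ℚ) :
    Valued.v (algebraMap _ (Kw p L w) y) = (Valued.v y : WithZero (Multiplicative ℤ)) ^ w.1.asIdeal.ramificationIdx (𝓞 ℚ) :=
  HeightOneSpectrum.Extension.valued_adicCompletionSemialgHom ℚ L w y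

/-- **`v_w(p) = exp(−e(w∣p))`** in `K_w`. [cite: CasselsFrohlichANT1967, Ch. II §10] -/
theorem valued_natCast_prime :
    Valued.v ((p : ℕ) : Kw p L w) =
      (WithZero.exp (-(w.1.asIdeal.ramificationIdx (𝓞 ℚ) : ℤ)) : WithZero (Multiplicative ℤ)) := by
  rw [← map_natCast (algebraMap (((Rat.HeightOneSpectrum.primesEquiv (R := 𝓞 ℚ)).symm ⟨p, hp.out⟩).adicCompletion ℚ)
    (Kw p L w)) p, valued_algebraMap_completion, valued_completion_natCast_prime, ← WithZero.exp_nsmul]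
  simp

/-- **`‖p‖ = p⁻¹` in `K_w` for `w` UNRAMIFIED over `p`** (`e(w∣p) = 1`). [cite: SerreLocalFields1979, Ch. II §1] -/
theorem norm_natCast_prime (he : w.1.asIdeal.ramificationIdx (𝓞 ℚ) = 1) : ‖((p : ℕ) : Kw p L w)‖ = (p : ℝ)⁻¹ := by
  rw [norm_eq_zpow (n := -1) (by rw [valued_natCast_prime, he]; rfl), zpow_neg, zpow_one]

/-! ## `ℤ_p → 𝒪_w`; the norm of `K_w` EXTENDS `|·|_p` for unramified `w` (`NormedAlgebra ℚ_[p] K_w`) -/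

/-- `algebraMap` carries `ℤ_p` into the unit ball of `K_w` (`e_p(ℤ_p) = 𝒪_v`, `𝒪_v → 𝒪_w`). [cite: CasselsFrohlichANT1967, Ch. II §10] -/
theorem norm_algebraMap_padicInt_le_one (s : ℤ_[p]) : ‖algebraMap ℚ_[p] (Kw p L w) (s : ℚ_[p])‖ ≤ 1 := by
  rw [← mem_unitBall_iff, mem_unitBall_iff_mem_adicCompletionIntegers, algebraMap_eq]
  have hs : Padic.adicCompletionEquiv (𝓞 ℚ) ⟨p, hp.out⟩ (s : ℚ_[p]) ∈
      ((Rat.HeightOneSpectrum.primesEquiv (R := 𝓞 ℚ)).symm ⟨p, hp.out⟩).adicCompletionIntegers ℚ := by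
    rw [← PadicInt.coe_adicCompletionIntegersEquiv_apply]
    exact (PadicInt.adicCompletionIntegersEquiv (𝓞 ℚ) ⟨p, hp.out⟩ s).2
  exact w.adicCompletionSemialgHom_image_adicCompletionIntegers ℚ L ⟨_, hs, rfl⟩

/-- `‖r‖ ≤ 1 ⇒ ‖algebraMap r‖ ≤ 1`. [cite: CasselsFrohlichANT1967, Ch. II §10] -/
theorem norm_algebraMap_le_one_of_norm_le_one {r : ℚ_[p]} (hr : ‖r‖ ≤ 1) :
    ‖algebraMap ℚ_[p] (Kw p L w) r‖ ≤ 1 :=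
  norm_algebraMap_padicInt_le_one (⟨r, hr⟩ : ℤ_[p])

/-- Units of `ℤ_p` go to elements of norm `1`. [cite: SerreLocalFields1979, Ch. II §2] -/
theorem norm_algebraMap_eq_one_of_norm_eq_one {u : ℚ_[p]} (hu : ‖u‖ = 1) :
    ‖algebraMap ℚ_[p] (Kw p L w) u‖ = 1 := by
  have hu0 : u ≠ 0 := norm_pos_iff.mp (by rw [hu]; exact one_pos)
  have h1 : ‖algebraMap ℚ_[p] (Kw p L w) u‖ ≤ 1 := norm_algebraMap_le_one_of_norm_le_one hu.le
  have h2 : ‖algebraMap ℚ_[p] (Kw p L w) u⁻¹‖ ≤ 1 :=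
    norm_algebraMap_le_one_of_norm_le_one (by rw [norm_inv, hu, inv_one])
  have h12 : ‖algebraMap ℚ_[p] (Kw p L w) u‖ * ‖algebraMap ℚ_[p] (Kw p L w) u⁻¹‖ = 1 := by
    rw [← norm_mul, ← map_mul, mul_inv_cancel₀ hu0, map_one, norm_one]
  refine le_antisymm h1 ?_
  calc (1 : ℝ) = ‖algebraMap ℚ_[p] (Kw p L w) u‖ * ‖algebraMap ℚ_[p] (Kw p L w) u⁻¹‖ := h12.symm
    _ ≤ ‖algebraMap ℚ_[p] (Kw p L w) u‖ * 1 := mul_le_mul_of_nonneg_left h2 (norm_nonneg _)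
    _ = ‖algebraMap ℚ_[p] (Kw p L w) u‖ := mul_one _

/-- **The norm of `K_w` extends `|·|_p`** for `w` unramified over `p`: `‖algebraMap r‖ = ‖r‖` (write
`r = u · p^n` with `‖u‖ = 1`). [cite: SerreLocalFields1979, Ch. II §2] -/
theorem norm_algebraMap_eq (he : w.1.asIdeal.ramificationIdx (𝓞 ℚ) = 1) (r : ℚ_[p]) :
    ‖algebraMap ℚ_[p] (Kw p L w) r‖ = ‖r‖ := by
  by_cases hr : r = 0
  · rw [hr, map_zero, norm_zero, norm_zero]
  have hp0 : (p : ℚ_[p]) ≠ 0 := Nat.cast_ne_zero.mpr hp.out.ne_zero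
  have hpR : (p : ℝ) ≠ 0 := Nat.cast_ne_zero.mpr hp.out.ne_zero
  set u : ℚ_[p] := r * (p : ℚ_[p]) ^ (-r.valuation) with hu_def
  have hu : ‖u‖ = 1 := by
    rw [hu_def, norm_mul, Padic.norm_p_zpow, Padic.norm_eq_zpow_neg_valuation hr, ← zpow_add₀ hpR, neg_neg,
      neg_add_cancel, zpow_zero]
  have hr' : r = u * (p : ℚ_[p]) ^ r.valuation := by
    rw [hu_def, mul_assoc, ← zpow_add₀ hp0, neg_add_cancel, zpow_zero, mul_one]
  rw [hr', map_mul, norm_mul, norm_mul, norm_algebraMap_eq_one_of_norm_eq_one hu, hu, map_zpow₀, norm_zpow,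
    map_natCast, norm_natCast_prime he, Padic.norm_p_zpow, inv_zpow', zpow_neg]

/-- **`NormedAlgebra ℚ_[p] K_w` for `w` unramified over `p`** (the port's standing structure on `K`);
the unramifiedness `e(w∣p) = 1` is supplied as a `Fact` (for `L = ℚ(ζ_m)`, `p ∤ m`, see
`…KPortJunction`). [cite: SerreLocalFields1979, Ch. II §2] -/
instance instNormedAlgebra [he : Fact (w.1.asIdeal.ramificationIdx (𝓞 ℚ) = 1)] : NormedAlgebra ℚ_[p] (Kw p L w) :=
  { (inferInstance : Algebra ℚ_[p] (Kw p L w)) with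
    norm_smul_le := fun r x => by
      rw [Algebra.smul_def, norm_mul, norm_algebraMap_eq he.out] }

/-! ## `K_w` is finite-dimensional over `ℚ_[p]` -/

/-- **`K_w` is finite-dimensional over `ℚ_[p]`** (`ℚ_[p] ≅ ℚ_v` and `[L_w : ℚ_v] < ∞`, packet).
[cite: CasselsFrohlichANT1967, Ch. II §10] -/
instance instFiniteDimensional : FiniteDimensional ℚ_[p] (Kw p L w) := by
  letI : Algebra ℚ_[p] (((Rat.HeightOneSpectrum.primesEquiv (R := 𝓞 ℚ)).symm ⟨p, hp.out⟩).adicCompletion ℚ) :=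
    (Padic.adicCompletionEquiv (𝓞 ℚ) ⟨p, hp.out⟩).toRingEquiv.toRingHom.toAlgebra
  haveI : IsScalarTower ℚ_[p] (((Rat.HeightOneSpectrum.primesEquiv (R := 𝓞 ℚ)).symm ⟨p, hp.out⟩).adicCompletion ℚ)
      (Kw p L w) := IsScalarTower.of_algebraMap_eq fun r => rfl
  haveI : Module.Finite ℚ_[p] (((Rat.HeightOneSpectrum.primesEquiv (R := 𝓞 ℚ)).symm ⟨p, hp.out⟩).adicCompletion ℚ) :=
    Module.Finite.of_surjective (Algebra.linearMap ℚ_[p] _)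
      (Padic.adicCompletionEquiv (𝓞 ℚ) ⟨p, hp.out⟩).surjective
  exact Module.Finite.trans (((Rat.HeightOneSpectrum.primesEquiv (R := 𝓞 ℚ)).symm ⟨p, hp.out⟩).adicCompletion ℚ) (Kw p L w)

/-! ## The port's unramifiedness hypothesis `hK` for `K_w` -/

/-- **`hK` for `K_w`**: for `w` unramified over `p`, `‖x‖ < 1 ⇒ ‖x‖ ≤ ‖p‖` on `K_w` (the value group is
`p^ℤ` and `‖p‖ = p⁻¹`). [cite: SerreLocalFields1979, Ch. II §1] -/
theorem norm_le_norm_prime_of_norm_lt_one (he : w.1.asIdeal.ramificationIdx (𝓞 ℚ) = 1) (x : Kw p L w)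
    (hx : ‖x‖ < 1) : ‖x‖ ≤ ‖((p : ℕ) : Kw p L w)‖ := by
  by_cases hx0 : x = 0
  · rw [hx0, norm_zero]; exact norm_nonneg _
  have hv0 : (Valued.v x : WithZero (Multiplicative ℤ)) ≠ 0 := (Valuation.ne_zero_iff _).mpr hx0
  have hlt : (Valued.v x : WithZero (Multiplicative ℤ)) < 1 := (norm_lt_one_iff x).mp hx
  have hlog : WithZero.log (Valued.v x : WithZero (Multiplicative ℤ)) ≤ -1 := by
    have h0 : WithZero.log (Valued.v x : WithZero (Multiplicative ℤ)) < 0 :=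
      (WithZero.log_lt_iff_lt_exp hv0).mpr (by rw [WithZero.exp_zero]; exact hlt)
    omega
  have hvx : (Valued.v x : WithZero (Multiplicative ℤ)) = WithZero.exp (WithZero.log (Valued.v x)) :=
    (WithZero.exp_log hv0).symm
  rw [norm_eq_zpow hvx, norm_natCast_prime he, ← zpow_neg_one]
  exact zpow_le_zpow_right₀ (by exact_mod_cast hp.out.one_lt.le) hlog

/-- `K_w` is an ultrametric space (inherited from the valued structure). [folklore] -/
theorem isUltrametricDist : IsUltrametricDist (Kw p L w) := inferInstance

end Kw

end Summit.BirchSwinnertonDyer.BirchSwinnertonDyer.Theorems.KPort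

end
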